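import Summits.QuantumFields.BalabanUV.T4Continuum.Support.B13TermData
import Summits.QuantumFields.BalabanUV.T4Continuum.Support.B13StepOfRecordSecantEnd

/-!
# NE5 ∕ U3 — the `act` SLOT of the step model of record `B13StepOfRecord.step` IN (2.14)-TERM FORMAT: `TermSlots` (= `Slots` with term
# cores in place of the activity functional), and this row's history STRUCTURE for that model BY CONSTRUCTION modulo ONE inline binder `refF`
# (row O1-d2 follower, part 2 of 2; part 1 = `B13TermData`)

Cell `pub-balaban`, unit `b2b-balaban-t4-ne5-formalise-leaf-08` (NE5 formalisation swarm, LEAF PROVER 08, gen 2; row O1-d2 holder).  Summits-side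
NEW WORK under the LEAN PLACEMENT RULE (cell bookkeeping; NOT a Literature module).  HONEST FRAMING: rung (B)+1 of the FINITE-VOLUME T⁴ continuum
programme — NOT infinite volume, NOT a mass gap, NOT the Clay problem, NOT a proof of NE5 (NOT PRINTED; cell GAPS G-t4-U3-1).  HONEST DEPENDENCY
(cell line, verbatim): continuum YM on T⁴ ⇐ BetaPertH ∧ nine spine estimates (0/9 proved); BetaPertH ⇐ (D1) ∧ (D4) ∧ CAP+tail; G-an2-4 gates
asym, D1 and NE2/3/4.

WHAT.  `B13StepOfRecord.Slots R E IOp Hist` (leaf-09, p208933) bundles the analytic data of the instance of record as parameters; here its first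
slot is put in term format: `TermSlots R P dom …` carries the per-step formats `F k` (as `Slots`; fork F1 untouched), per-step B13 weights
`G k` (leaf-07's geometry letters), the raw species, the insertion datum over `Hist := B13HistM P` (fork F2's default), the margins, and a
family of term CORES `core Z ℓ` (part 1's `TermCore`);
`TermSlots.toSlots` sets `act := actOf (termData F G rHist core)`.  For the model `B13StepOfRecord.step 𝔖.toSlots E₀ cB` (`step_Out_toSlots`,
`rfl`): `linearHistoryOn_toSlots`, **`actExpLinearOn_toSlots`**, `termHistExpLinear_toSlots`, `termHistLineAnalytic_toSlots`,
`actExpNormBound_toSlots` (in the model's own margins `(step …).rHist = 𝔖.rHist`, modulus `rHist k·Σ_{Y∈𝐃}‖τ Y‖·level136 (d (dom Y))`) and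
`actAbsBound_toSlots` — i.e. on this model the binders `hexp` ∕ `hN` of leaf-03's `histSecant_socket_of_actNormDecay` ∕
`histFibreEnvelopeCl_socket_of_actNormDecay` (p210690) and of `B13StepSecantEnd` read «`refF`» (integrability of the cores' tilted integrands
at the class points, (2.15) p. 15 KIND — ONE inline binder, no `def … : Prop`) and a displayed number per term; `habs` reads the (2.15)
sizes `‖z⁻¹‖·∫‖F‖`.  `entry_opB_toSlots`: the term data's kernels at run B's datum ARE the raw species (leaf-07's `entry_assemble`).
§2 CONSUMER FIT IN THE KERNEL: **`exists_ne5_of_record_secant_termData`** = leaf-01's secant END of record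
`B13StepOfRecordSecantEnd.exists_ne5_of_record_secant_actNormDecay` (p211635 ACCEPTED a7d72f772e7a) at `S := 𝔖.toSlots` with `hexp`, `hN`, `hN0`,
`habs` DISCHARGED BY NAME — an END application in a new module (precedents `B13StepEnd`, `B13StepEndInsOp`), no END module edited.
HONEST RESIDUE.  NOT the owner's sub-row «O1-d2-ii act instance» (the cores are NAMED PARAMETERS; nothing of [II]'s contours∕measures is
constructed); no END is re-wired; no estimate of [II] is proved or asserted; `BetaPertH`, (B), (B^μ) absent.  0 sorry; no new axioms.
-/

noncomputable section

open MeasureTheory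
open scoped BigOperators

namespace Summit.QuantumFields.BalabanUV.T4Continuum.B13StepOfRecordTermData

open Literature.MathematicalPhysics.QuantumFieldTheory.Balaban1983to89
open Literature.MathematicalPhysics.QuantumFieldTheory.Balaban1983to89.T4OutputRate (Carriers DecayBound NE5)
open Literature.MathematicalPhysics.QuantumFieldTheory.Balaban1983to89.T4InputCauchyRateSpecies (ballClass OpLipschitz)
open Literature.MathematicalPhysics.QuantumFieldTheory.Balaban1983to89.T4InputCauchyRateTermwise
  (TermHistExpLinear TermHistLineAnalytic)
open Summit.QuantumFields.BalabanUV.T4Continuum.B13OpDatum (Format OpDatum entry Species B13Weights)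
open Summit.QuantumFields.BalabanUV.T4Continuum.B13HistDatum (level136)
open Summit.QuantumFields.BalabanUV.T4Continuum.B13HistMeasurable (MeasPotFrame B13HistM)
open Summit.QuantumFields.BalabanUV.T4Continuum.B13StepTermFamily
  (TermIndexing ActExpLinearOn term out tupleMeasure tupleWeight tupleFunctional)
open Summit.QuantumFields.BalabanUV.T4Continuum.B13StepTermExpLinear (actOf dataOf LinearHistoryOn)
open Summit.QuantumFields.BalabanUV.T4Continuum.B13TermHistSecant (ActExpNormBound ActAbsBound)
open Summit.QuantumFields.BalabanUV.T4Continuum.B13Carriers (TwoRuns)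
open Summit.QuantumFields.BalabanUV.T4Continuum.B13HistInsertion (InsDatum)
open Summit.QuantumFields.BalabanUV.T4Continuum.B13StepTermLabels (TermIdx InnerLabel)
open Summit.QuantumFields.BalabanUV.T4Continuum.B13StepTermSocket (labelsIndexing touchInc)
open Summit.QuantumFields.BalabanUV.T4Continuum.B13InnerData (Bnd b13InnerData)
open Summit.QuantumFields.BalabanUV.T4Continuum.B13OpDatumJunctions (RawBounded WeightedEntrywiseRate)
open Summit.QuantumFields.BalabanUV.T4Continuum.B13ActMajorantLevels (polyWeight)
open Summit.QuantumFields.BalabanUV.T4Continuum.UrsellTreeSum (ind)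
open Summit.QuantumFields.BalabanUV.T4Continuum.B13Base (selfCtr)
open Summit.QuantumFields.BalabanUV.T4Continuum.B13DomainGeometryTR (SCube footprint)
open Summit.QuantumFields.BalabanUV.T4Continuum.B13StepOfRecord (Slots assembly step outA outB)
open Summit.QuantumFields.BalabanUV.T4Continuum.B13StepOfRecordSecantEnd (exists_ne5_of_record_secant_actNormDecay)
open Summit.QuantumFields.BalabanUV.T4Continuum.B13TermData
  (TermCore termData histLs margins linearHistoryOn_termData actExpLinearOn_termData termHistExpLinear_termData
    termHistLineAnalytic_termData actExpNormBound_termData actAbsBound_termData)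

/-! ## §1 On the carriers, indexing and hard core OF RECORD: `B13StepOfRecord.step` with the activity slot in term format -/

section OfRecord

variable {𝔾 : Type} [GaugeGroup 𝔾] (R : TwoRuns 𝔾) (P : MeasPotFrame R.carriers) {𝒴 : Type*} (dom : 𝒴 → R.carriers.Dom)
  (T κ ι S Ω Ω₀ 𝒞 IOp : Type*) [MeasurableSpace Ω] [MeasurableSpace Ω₀]

/-- [folklore] DATA (no inequality inside): `B13StepOfRecord.Slots` WITH THE ACTIVITY SLOT IN TERM FORMAT — per-step B13 weights `G k`
and formats `F k`, the two runs' raw species, the insertion datum over the measurable history space (fork F2's default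
`Hist := B13HistM P`), the margins, and the family of term CORES `core Z ℓ` at every polymer and inner label of record. -/
structure TermSlots where
  /-- per-step entry formats of the operator datum (as in `Slots`; fork F1's choice lives here) -/
  F : ℕ → Format (Species T κ ι Ω 𝒴)
  /-- per-step B13 weights (the terms' geometry letters `d p q δ τ w kk v`) -/
  G : ℕ → B13Weights κ ι S 𝒴
  /-- run A's raw species at a run-A background -/
  rawA : (ℕ → ℝ) → R.carriers.BgA → ℕ → Species T κ ι Ω 𝒴 → ℂ
  /-- run B's raw species -/
  rawB : (ℕ → ℝ) → R.carriers.BgB → ℕ → Species T κ ι Ω 𝒴 → ℂ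
  /-- the insertion datum -/
  D : InsDatum R.carriers IOp (B13HistM P)
  /-- operator margin -/
  rOp : ℕ → ℝ
  /-- history margin -/
  rHist : ℕ → ℝ
  rOp_pos : ∀ k, 0 < rOp k
  rHist_pos : ∀ k, 0 < rHist k
  /-- the term cores at every polymer and inner label of record -/
  core : R.carriers.Dom → InnerLabel R.carriers.Dom (Bnd R) → TermCore P dom T κ ι Ω Ω₀ 𝒞

namespace TermSlots

variable {R P dom T κ ι S Ω Ω₀ 𝒞 IOp} [Fintype ι] [Fintype κ] [DecidableEq ι] [DecidableEq κ]
  (𝔖 : TermSlots R P dom T κ ι S Ω Ω₀ 𝒞 IOp)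

/-- [folklore] **THE SLOTS OF RECORD WITH `act := actOf (termData F G rHist core)`** (formats, raw species, insertion datum, margins as given). -/
def toSlots : Slots R (Species T κ ι Ω 𝒴) IOp (B13HistM P) where
  act := actOf (termData 𝔖.F 𝔖.G 𝔖.rHist 𝔖.core)
  F := 𝔖.F
  rawA := 𝔖.rawA
  rawB := 𝔖.rawB
  D := 𝔖.D
  rOp := 𝔖.rOp
  rHist := 𝔖.rHist
  rOp_pos := 𝔖.rOp_pos
  rHist_pos := 𝔖.rHist_pos

variable (E₀ cB : ℝ)

/-- [folklore] The output of the model of record with term-format slots IS this row's `out` on the indexing and hard core of record at the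
activity terms `actOf (termData …)` (`rfl`, through leaf-09's `step_Out`). -/
theorem step_Out_toSlots : (step 𝔖.toSlots E₀ cB).Out =
    out (labelsIndexing (B13DomainGeometryTR.domainGeometry R) (b13InnerData R))
      (touchInc (B13DomainGeometryTR.domainGeometry R)) (actOf (termData 𝔖.F 𝔖.G 𝔖.rHist 𝔖.core)) := rfl

/-- [folklore] The activity slot and the history margin of that model (`rfl`). -/
theorem toSlots_act : 𝔖.toSlots.act = actOf (termData 𝔖.F 𝔖.G 𝔖.rHist 𝔖.core) := rfl
/-- [folklore] -/
theorem step_rHist_toSlots : (step 𝔖.toSlots E₀ cB).rHist = 𝔖.rHist := rfl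

/-- [folklore] The formats of that model read the raw species back: at run B's step-`k` datum the entry `e` is `rawB g U k e` whenever the
raw kernel is format-bounded (leaf-07's `entry_assemble`) — so the term data's kernels at `opB g U k` ARE the raw species at the slot. -/
theorem entry_opB_toSlots {g : ℕ → ℝ} {U : R.carriers.BgB} {k : ℕ} (h : B13OpDatum.FormatBounded (𝔖.F k) (𝔖.rawB g U k))
    (e : Species T κ ι Ω 𝒴) : entry (𝔖.F k) ((step 𝔖.toSlots E₀ cB).opB g U k) e = 𝔖.rawB g U k e :=
  B13OpDatum.entry_assemble h e

variable {K : ℕ → (ℕ → ℝ) → R.carriers.BgB → Set (OpDatum (Species T κ ι Ω 𝒴) × B13HistM P)} {W : Set (ℕ → ℝ)}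

/-! THE ONE DISPLAYED BINDER OF THIS SECTION (a section variable, included below): `refF` — at every class point `q` of step `k`, every factor
`(Z, ℓ)` of every tuple of record localizing at a step-`k` domain has an INTEGRABLE tilted integrand `F q` for its core's measure (route P2's
`RefAt.hF`; the one-run integrability behind (2.15) p. 15 of [Balaban1988RG2Cluster] — KIND, locator only, asserted nowhere). -/
variable
  (refF : ∀ k, ∀ g ∈ W, ∀ (U : R.carriers.BgB) (q : OpDatum (Species T κ ι Ω 𝒴) × B13HistM P), q ∈ K k g U →
    ∀ X : R.carriers.Dom, R.carriers.scale X = k →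
      ∀ i : TermIdx R.carriers.Dom (Bnd R), (labelsIndexing (B13DomainGeometryTR.domainGeometry R) (b13InnerData R)).Rel k i X →
        ∀ m, Integrable
          ((termData 𝔖.F 𝔖.G 𝔖.rHist 𝔖.core ((labelsIndexing (B13DomainGeometryTR.domainGeometry R) (b13InnerData R)).poly i m)
            ((labelsIndexing (B13DomainGeometryTR.domainGeometry R) (b13InnerData R)).lab i m)).F q)
          (𝔖.core ((labelsIndexing (B13DomainGeometryTR.domainGeometry R) (b13InnerData R)).poly i m)
            ((labelsIndexing (B13DomainGeometryTR.domainGeometry R) (b13InnerData R)).lab i m)).ν)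
include refF

/-- [folklore] **THIS ROW's `LinearHistoryOn` ON THE MODEL OF RECORD** (indexing `labelsIndexing (TR.domainGeometry R) (b13InnerData R)`),
modulo `refF` only. -/
theorem linearHistoryOn_toSlots :
    LinearHistoryOn (labelsIndexing (B13DomainGeometryTR.domainGeometry R) (b13InnerData R)) (termData 𝔖.F 𝔖.G 𝔖.rHist 𝔖.core)
      (histLs 𝔖.core) (margins 𝔖.rHist) K W :=
  linearHistoryOn_termData _ _ _ _ _ 𝔖.rHist_pos refF

/-- [folklore] **`ActExpLinearOn` FOR THE MODEL OF RECORD's ACTIVITY SLOT** — the binder `hexp` of every O2-hist face and of the secant END on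
`B13StepOfRecord.step` (`B13TermHistSecant*`, `B13StepSecantEnd`, `B13StepOfRecordSecantEnd`) is, for term-format slots, a THEOREM modulo
`refF`. -/
theorem actExpLinearOn_toSlots :
    ActExpLinearOn (labelsIndexing (B13DomainGeometryTR.domainGeometry R) (b13InnerData R)) 𝔖.toSlots.act
      (dataOf (termData 𝔖.F 𝔖.G 𝔖.rHist 𝔖.core) (histLs 𝔖.core)) K W :=
  actExpLinearOn_termData _ _ _ _ _ 𝔖.rHist_pos refF

/-- [folklore] **`TermHistExpLinear` FOR THE MODEL OF RECORD's OWN TERM FAMILY** (hard core of record), modulo `refF`. -/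
theorem termHistExpLinear_toSlots :
    TermHistExpLinear K
      (term (labelsIndexing (B13DomainGeometryTR.domainGeometry R) (b13InnerData R))
        (touchInc (B13DomainGeometryTR.domainGeometry R)) 𝔖.toSlots.act) W
      (α := fun _ i => Fin ((labelsIndexing (B13DomainGeometryTR.domainGeometry R) (b13InnerData R)).len i + 1) → Ω)
      (fun _ i o _ => tupleMeasure (labelsIndexing (B13DomainGeometryTR.domainGeometry R) (b13InnerData R))
        (dataOf (termData 𝔖.F 𝔖.G 𝔖.rHist 𝔖.core) (histLs 𝔖.core)) i o)
      (fun k i o X => tupleWeight (labelsIndexing (B13DomainGeometryTR.domainGeometry R) (b13InnerData R))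
        (touchInc (B13DomainGeometryTR.domainGeometry R)) (dataOf (termData 𝔖.F 𝔖.G 𝔖.rHist 𝔖.core) (histLs 𝔖.core)) k i o X)
      (fun k i o X => tupleFunctional (labelsIndexing (B13DomainGeometryTR.domainGeometry R) (b13InnerData R))
        (dataOf (termData 𝔖.F 𝔖.G 𝔖.rHist 𝔖.core) (histLs 𝔖.core)) k i o X) :=
  termHistExpLinear_termData _ _ _ _ _ 𝔖.rHist_pos refF _

/-- [folklore] **`TermHistLineAnalytic` FOR THE MODEL OF RECORD's TERM FAMILY**, modulo `refF`. -/
theorem termHistLineAnalytic_toSlots :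
    TermHistLineAnalytic K
      (term (labelsIndexing (B13DomainGeometryTR.domainGeometry R) (b13InnerData R))
        (touchInc (B13DomainGeometryTR.domainGeometry R)) 𝔖.toSlots.act) W :=
  termHistLineAnalytic_termData _ _ _ _ _ 𝔖.rHist_pos refF _

/-- [folklore] **LEAF-03's `hN` ON THE MODEL OF RECORD IN THE MODEL's OWN HISTORY MARGINS** (`(step 𝔖.toSlots E₀ cB).rHist = 𝔖.rHist`), with
the explicit modulus `rHist k · Σ_{Y ∈ 𝐃(Z ℓ)} ‖τ Y‖·level136 (d (dom Y))`, modulo `refF`. -/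
theorem actExpNormBound_toSlots :
    ActExpNormBound (labelsIndexing (B13DomainGeometryTR.domainGeometry R) (b13InnerData R))
      (dataOf (termData 𝔖.F 𝔖.G 𝔖.rHist 𝔖.core) (histLs 𝔖.core)) K W (step 𝔖.toSlots E₀ cB).rHist
      (fun k _ _ Z ℓ => 𝔖.rHist k *
        ∑ Y ∈ (𝔖.core Z ℓ).D, ‖(𝔖.G (R.carriers.scale Z)).τ Y‖ * level136 P.consts (R.carriers.d (dom Y))) :=
  actExpNormBound_termData _ _ _ _ _ 𝔖.rHist_pos refF fun k => (𝔖.rHist_pos k).le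

/-- [folklore] **LEAF-03's `habs` ON THE MODEL OF RECORD FROM DISPLAYED (2.15)-SIZES** of the cores' tilted integrands at the class points. -/
theorem actAbsBound_toSlots {A : ℕ → (ℕ → ℝ) → R.carriers.BgB → R.carriers.Dom → InnerLabel R.carriers.Dom (Bnd R) → ℝ}
    (hA : ∀ k, ∀ g ∈ W, ∀ (U : R.carriers.BgB) (q : OpDatum (Species T κ ι Ω 𝒴) × B13HistM P), q ∈ K k g U →
      ∀ X : R.carriers.Dom, R.carriers.scale X = k →
        ∀ i : TermIdx R.carriers.Dom (Bnd R), (labelsIndexing (B13DomainGeometryTR.domainGeometry R) (b13InnerData R)).Rel k i X →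
          ∀ m, ‖((termData 𝔖.F 𝔖.G 𝔖.rHist 𝔖.core
                ((labelsIndexing (B13DomainGeometryTR.domainGeometry R) (b13InnerData R)).poly i m)
                ((labelsIndexing (B13DomainGeometryTR.domainGeometry R) (b13InnerData R)).lab i m)).z q.1)⁻¹‖ *
              ∫ x, ‖(termData 𝔖.F 𝔖.G 𝔖.rHist 𝔖.core
                ((labelsIndexing (B13DomainGeometryTR.domainGeometry R) (b13InnerData R)).poly i m)
                ((labelsIndexing (B13DomainGeometryTR.domainGeometry R) (b13InnerData R)).lab i m)).F q x‖
                ∂(𝔖.core ((labelsIndexing (B13DomainGeometryTR.domainGeometry R) (b13InnerData R)).poly i m)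
                  ((labelsIndexing (B13DomainGeometryTR.domainGeometry R) (b13InnerData R)).lab i m)).ν ≤
            A k g U ((labelsIndexing (B13DomainGeometryTR.domainGeometry R) (b13InnerData R)).poly i m)
              ((labelsIndexing (B13DomainGeometryTR.domainGeometry R) (b13InnerData R)).lab i m)) :
    ActAbsBound (labelsIndexing (B13DomainGeometryTR.domainGeometry R) (b13InnerData R))
      (dataOf (termData 𝔖.F 𝔖.G 𝔖.rHist 𝔖.core) (histLs 𝔖.core)) K W A :=
  actAbsBound_termData _ _ _ _ _ 𝔖.rHist_pos refF hA

end TermSlots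

/-! ## §2 Consumer fit in the kernel: leaf-01's SECANT END OF RECORD with the history-structure binders DISCHARGED for term-format slots -/

namespace TermSlots

variable {R P dom T κ ι S Ω Ω₀ 𝒞 IOp} [Fintype ι] [Fintype κ] [DecidableEq ι] [DecidableEq κ]
  (𝔖 : TermSlots R P dom T κ ι S Ω Ω₀ 𝒞 IOp) (E₀ cB : ℝ)

omit [Fintype ι] [Fintype κ] [DecidableEq ι] [DecidableEq κ] in
/-- [folklore] The explicit exponent modulus is nonnegative (positive margins, `level136 > 0`). -/
theorem expModulus_nonneg (k : ℕ) (Z : R.carriers.Dom) (ℓ : InnerLabel R.carriers.Dom (Bnd R)) :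
    0 ≤ 𝔖.rHist k * ∑ Y ∈ (𝔖.core Z ℓ).D, ‖(𝔖.G (R.carriers.scale Z)).τ Y‖ * level136 P.consts (R.carriers.d (dom Y)) :=
  mul_nonneg (𝔖.rHist_pos k).le (Finset.sum_nonneg fun _ _ =>
    mul_nonneg (norm_nonneg _) (B13HistDatum.level136_pos P.pos _).le)

/-- [folklore] **THE SECANT END ON THE CARRIERS OF RECORD FOR TERM-FORMAT SLOTS** — leaf-01's
`B13StepOfRecordSecantEnd.exists_ne5_of_record_secant_actNormDecay` at `S := 𝔖.toSlots` with `hexp := actExpLinearOn_toSlots`,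
`hN := actExpNormBound_toSlots`, `hN0 := expModulus_nonneg`, `habs := actAbsBound_toSlots` BY NAME.  What the history half of W2 now
READS on this model: the one-run integrability `refF` ((2.15) KIND), a displayed NUMBER `N̄` bounding `rHist k·Σ_{Y∈𝐃(Z ℓ)}‖τ Y‖·level136`
per term ((2.20) KIND), displayed (2.15)-sizes `A` of the cores' tilted integrands on the budget ball class with their decay split against
`A′` and leaf-08's anchored exponential norm `Φ′` of `A′` (`36Φ′ < 1`); every OTHER binder is leaf-01's, passed through verbatim (reading,
slice budgets, L05∕L06, W1 entry rate, W4, `OpLipschitz`, radii, signs, smallness; the NE5 decay rate is written `ϰ` here, `κ` being the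
bond-site type).  NOT a proof of NE5: an implication from displayed
binders; no END module is edited. -/
theorem exists_ne5_of_record_secant_termData {W : Set (ℕ → ℝ)} {ROp RHist : ℕ → ℝ}
    {A A' : ℕ → (ℕ → ℝ) → R.carriers.BgB → R.carriers.Dom → InnerLabel R.carriers.Dom (Bnd R) → ℝ}
    {ϰ Λop Nbar Φ' EA₀ cA c₁ r₀ δ' θ θ' ρ₀ : ℝ}
    (refF : ∀ k, ∀ g ∈ W, ∀ (U : R.carriers.BgB) (q : OpDatum (Species T κ ι Ω 𝒴) × B13HistM P),
      q ∈ ballClass (selfCtr (assembly 𝔖.toSlots).raw (assembly 𝔖.toSlots).histRef) ROp RHist k g U →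
      ∀ X : R.carriers.Dom, R.carriers.scale X = k →
        ∀ i : TermIdx R.carriers.Dom (Bnd R), (labelsIndexing (B13DomainGeometryTR.domainGeometry R) (b13InnerData R)).Rel k i X →
          ∀ m, Integrable
            ((termData 𝔖.F 𝔖.G 𝔖.rHist 𝔖.core ((labelsIndexing (B13DomainGeometryTR.domainGeometry R) (b13InnerData R)).poly i m)
              ((labelsIndexing (B13DomainGeometryTR.domainGeometry R) (b13InnerData R)).lab i m)).F q)
            (𝔖.core ((labelsIndexing (B13DomainGeometryTR.domainGeometry R) (b13InnerData R)).poly i m)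
              ((labelsIndexing (B13DomainGeometryTR.domainGeometry R) (b13InnerData R)).lab i m)).ν)
    (hNbar0 : 0 ≤ Nbar)
    (hNle : ∀ k (Z : R.carriers.Dom) (ℓ : InnerLabel R.carriers.Dom (Bnd R)),
      𝔖.rHist k * ∑ Y ∈ (𝔖.core Z ℓ).D, ‖(𝔖.G (R.carriers.scale Z)).τ Y‖ * level136 P.consts (R.carriers.d (dom Y)) ≤ Nbar)
    (hA : ∀ k, ∀ g ∈ W, ∀ (U : R.carriers.BgB) (q : OpDatum (Species T κ ι Ω 𝒴) × B13HistM P),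
      q ∈ ballClass (selfCtr (assembly 𝔖.toSlots).raw (assembly 𝔖.toSlots).histRef) ROp RHist k g U →
      ∀ X : R.carriers.Dom, R.carriers.scale X = k →
        ∀ i : TermIdx R.carriers.Dom (Bnd R), (labelsIndexing (B13DomainGeometryTR.domainGeometry R) (b13InnerData R)).Rel k i X →
          ∀ m, ‖((termData 𝔖.F 𝔖.G 𝔖.rHist 𝔖.core
                ((labelsIndexing (B13DomainGeometryTR.domainGeometry R) (b13InnerData R)).poly i m)
                ((labelsIndexing (B13DomainGeometryTR.domainGeometry R) (b13InnerData R)).lab i m)).z q.1)⁻¹‖ *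
              ∫ x, ‖(termData 𝔖.F 𝔖.G 𝔖.rHist 𝔖.core
                ((labelsIndexing (B13DomainGeometryTR.domainGeometry R) (b13InnerData R)).poly i m)
                ((labelsIndexing (B13DomainGeometryTR.domainGeometry R) (b13InnerData R)).lab i m)).F q x‖
                ∂(𝔖.core ((labelsIndexing (B13DomainGeometryTR.domainGeometry R) (b13InnerData R)).poly i m)
                  ((labelsIndexing (B13DomainGeometryTR.domainGeometry R) (b13InnerData R)).lab i m)).ν ≤
            A k g U ((labelsIndexing (B13DomainGeometryTR.domainGeometry R) (b13InnerData R)).poly i m)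
              ((labelsIndexing (B13DomainGeometryTR.domainGeometry R) (b13InnerData R)).lab i m))
    (hA0 : ∀ k g U Z ℓ, 0 ≤ A k g U Z ℓ) (hA0' : ∀ k g U Z ℓ, 0 ≤ A' k g U Z ℓ) (hϰ : 0 ≤ ϰ)
    (hdec : ∀ k g U Z ℓ, A k g U Z ℓ ≤ A' k g U Z ℓ * Real.exp (-(ϰ * (R.carriers.d Z + 5))))
    (hΦ0 : 0 ≤ Φ') (hΦsmall : 36 * Φ' < 1)
    (hΦ : ∀ k, ∀ g ∈ W, ∀ (U : R.carriers.BgB) (q : SCube R),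
      ∑ Z ∈ R.domAt k, ind (q ∈ footprint Z) * polyWeight (b13InnerData R) (A' k g U) k Z *
        Real.exp ((footprint Z).card) ≤ Φ')
    (hT : (assembly 𝔖.toSlots).TransportReads W)
    (hbB : (assembly 𝔖.toSlots).SliceBudgetB W ϰ cB) (hbA : 𝔖.D.SliceBudget (step 𝔖.toSlots E₀ cB) W ϰ cA)
    (hdA : DecayBound (outA 𝔖.toSlots E₀ cB) W EA₀ ϰ) (hdB : DecayBound (outB 𝔖.toSlots E₀ cB) W E₀ ϰ)
    (hRA : RawBounded 𝔖.F (assembly 𝔖.toSlots).rawAt W) (hRB : RawBounded 𝔖.F 𝔖.rawB W)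
    (hwer : WeightedEntrywiseRate 𝔖.F (assembly 𝔖.toSlots).rawAt 𝔖.rawB W c₁ fun k => θ ^ k) (hfl : ∀ k, r₀ ≤ 𝔖.rOp k)
    (hins : (step 𝔖.toSlots E₀ cB).InsertionRate W ϰ E₀ δ' θ)
    (hopL : OpLipschitz (step 𝔖.toSlots E₀ cB) W ϰ Λop ρ₀)
    (hOp : ∀ k, c₁ / r₀ * 𝔖.rOp k ≤ ROp k) (hHist : ∀ k, (assembly 𝔖.toSlots).bHist E₀ cB k ≤ RHist k)
    (hHistA : ∀ k, δ' * 𝔖.rHist k + EA₀ * (𝔖.rHist k * (cA / (1 - 𝔖.D.ω))) ≤ RHist k)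
    (hEA₀ : 0 ≤ EA₀) (hE₀ : 0 ≤ E₀) (hΛop : 0 ≤ Λop) (hcA : 0 ≤ cA) (hcB : 0 ≤ cB)
    (hc₁ : 0 ≤ c₁) (hr₀ : 0 < r₀) (hδ' : 0 ≤ δ') (hθ0 : 0 < θ) (hθ1 : θ < 1) (hθθ' : θ ≤ θ') (hθ'1 : θ' ≤ 1)
    (hω : 0 < 𝔖.D.ω) (hω1 : 𝔖.D.ω < 1) (hρ₀ : 0 < ρ₀)
    (hsmall : 𝔖.D.ω + 2 * (Nbar * (Φ' / (1 - 36 * Φ') ^ 2)) * cA < θ') :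
    ∃ C₅, NE5 (outA 𝔖.toSlots E₀ cB) (outB 𝔖.toSlots E₀ cB) W ϰ θ' C₅ :=
  exists_ne5_of_record_secant_actNormDecay 𝔖.toSlots E₀ cB hT hbB hbA hdA hdB hRA hRB hwer hfl hins hopL
    (𝔖.actExpLinearOn_toSlots refF) (𝔖.actExpNormBound_toSlots E₀ cB refF) (fun k _ _ Z ℓ => 𝔖.expModulus_nonneg k Z ℓ)
    (fun k _ _ Z ℓ => hNle k Z ℓ) hNbar0 (𝔖.actAbsBound_toSlots refF hA) hA0 hA0' hϰ hdec hΦ0 hΦsmall hΦ hOp hHist hHistA hEA₀ hE₀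
    hΛop hcA hcB hc₁ hr₀ hδ' hθ0 hθ1 hθθ' hθ'1 hω hω1 hρ₀ hsmall

end TermSlots

end OfRecord

end Summit.QuantumFields.BalabanUV.T4Continuum.B13StepOfRecordTermData

end
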